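import Mathlib
import Literature.Probability.Percolation.QuadCrossingQuadTopology
import Literature.Probability.Percolation.QuadCrossingContinuityReduction
import HarnessLib

/-!
# A leaf of a chart meeting a nowhere dense closed set in a totally disconnected set

Crux `stmt-CriticalPhenomena-10269`
(`Summit.CriticalPhenomena.CardyFormulaZ2.Theses.CardySelfRefinement.GradientComparability`),
line **Sketch**, helper file of the stub `stub_bulkPivotalSum_diverges` (D3-bulk); the geometric
input of the non-degeneracy of the joint crossing event of a quad family GIVEN THE BOUNDARY LAYER:
the closed dual skeleton is placed along a leaf `H([-2,2] × {a})` of the straightening chart `H`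
of the first (transposed) quad, and the open skeletons must cross that leaf OFF the boundaries
`∂F = ⋃ᵢ ∂(F i)`; this is possible as soon as the leaf meets `∂F` in a set all of whose connected
subsets are points.

## Mathematics

**Theorem (`exists_leaf_subsingleton`, registered sub-goal).**  Let `H : ℂ ≃ₜ ℂ` and let
`S ⊆ ℂ` be closed with empty interior.  Then for some `a ∈ (-¼, ¼)` every preconnected subset of
`H([-2, 2] × {a}) ∩ S` is a subsingleton.

*Proof (Baire).*  Otherwise every leaf `a ∈ (-¼,¼)` carries a non-degenerate connected subset of
`S`, whose chart preimage is a non-degenerate segment `[x₁, x₂] × {a}`, hence contains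
`[q₁, q₂] × {a}` for rationals `q₁ < q₂`.  The sets `A_{q₁q₂} = {a ∈ [-¼,¼] | H([q₁,q₂] × {a}) ⊆ S}`
are closed and, together with `ℝ ∖ (-¼,¼)`, cover `ℝ`; by Baire one `A_{q₁q₂}` has an interior
point in `(-¼,¼)`, so `S ⊇ H((q₁,q₂) × (a₀−ε, a₀+ε))` has nonempty interior — a contradiction.

Also (`interior_boundaries_eq_empty`, `isClosed_boundaries`): the union of the sides of finitely
many quads is closed with empty interior (each side is the image under a straightening
homeomorphism of a piece of a line, `Quad.exists_straighten`).
-/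

noncomputable section

namespace Summit.CriticalPhenomena.CardyFormulaZ2.Theorems.CardySelfRefinement

open scoped Topology
open Filter Set MeasureTheory
open Literature.Probability.Percolation.QuadCrossing

/-! ## The boundaries of a quad family: closed, nowhere dense -/

/-- A side of a quad lies in the image under a homeomorphism of a line, a closed set with empty
interior. -/
theorem exists_side_subset_closed_nowhereDense (Q : Quad (Set.univ : Set ℂ)) (j : Fin 4) :
    ∃ T : Set ℂ, IsClosed T ∧ interior T = ∅ ∧ Q.side j ⊆ T := by
  obtain ⟨H, -, -, h0, h1, h2, h3⟩ := Q.exists_straighten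
  -- the two lines `re = c`, `im = c` and their images
  have hline : ∀ (f : ℂ → ℝ), (f = Complex.re ∨ f = Complex.im) → ∀ c : ℝ,
      IsClosed (H '' {z | f z = c}) ∧ interior (H '' {z | f z = c}) = ∅ := by
    intro f hf c
    have hfc : Continuous f := by rcases hf with rfl | rfl <;> fun_prop
    refine ⟨(H.isClosed_image).2 (isClosed_eq hfc continuous_const), ?_⟩
    rw [← H.image_interior, Set.image_eq_empty]
    -- a line has empty interior: perturb a putative interior point off the line
    rw [Set.eq_empty_iff_forall_notMem]
    intro z hz
    rw [mem_interior_iff_mem_nhds, Metric.mem_nhds_iff] at hz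
    obtain ⟨ε, hε, hball⟩ := hz
    rcases hf with rfl | rfl
    · have hmem : z + (ε / 2 : ℝ) ∈ Metric.ball z ε := by
        rw [Metric.mem_ball, dist_eq_norm, add_sub_cancel_left, Complex.norm_real, Real.norm_eq_abs,
          abs_of_pos (half_pos hε)]
        linarith
      have h1 := hball hmem
      have h2 := hball (Metric.mem_ball_self hε)
      simp only [Set.mem_setOf_eq, Complex.add_re, Complex.ofReal_re] at h1 h2
      linarith
    · have hmem : z + (ε / 2 : ℝ) * Complex.I ∈ Metric.ball z ε := by
        rw [Metric.mem_ball, dist_eq_norm, add_sub_cancel_left, norm_mul, Complex.norm_real,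
          Complex.norm_I, mul_one, Real.norm_eq_abs, abs_of_pos (half_pos hε)]
        linarith
      have h1 := hball hmem
      have h2 := hball (Metric.mem_ball_self hε)
      simp only [Set.mem_setOf_eq, Complex.add_im, Complex.mul_im, Complex.ofReal_re,
        Complex.I_im, Complex.ofReal_im, Complex.I_re, mul_one, mul_zero, add_zero] at h1 h2
      linarith
  have hsub : ∀ (f : ℂ → ℝ) (c : ℝ),
      H '' {z | z ∈ Icc (-1 : ℝ) 1 ×ℂ Icc (-1 : ℝ) 1 ∧ f z = c} ⊆ H '' {z | f z = c} :=
    fun f c => Set.image_mono fun z hz => hz.2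
  fin_cases j
  · obtain ⟨hc, hi⟩ := hline Complex.re (Or.inl rfl) (-1)
    exact ⟨_, hc, hi, h0 ▸ hsub Complex.re (-1)⟩
  · obtain ⟨hc, hi⟩ := hline Complex.im (Or.inr rfl) (-1)
    exact ⟨_, hc, hi, h1 ▸ hsub Complex.im (-1)⟩
  · obtain ⟨hc, hi⟩ := hline Complex.re (Or.inl rfl) 1
    exact ⟨_, hc, hi, h2 ▸ hsub Complex.re 1⟩
  · obtain ⟨hc, hi⟩ := hline Complex.im (Or.inr rfl) 1
    exact ⟨_, hc, hi, h3 ▸ hsub Complex.im 1⟩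

/-- The union of the sides of finitely many quads is closed. -/
theorem isClosed_boundaries (m : ℕ) (F : Fin m → Quad (Set.univ : Set ℂ)) :
    IsClosed (⋃ i : Fin m, ⋃ j : Fin 4, (F i).side j) :=
  isClosed_iUnion_of_finite fun i => isClosed_iUnion_of_finite fun j =>
    ((F i).isCompact_side j).isClosed

/-- The union of the sides of finitely many quads has empty interior. -/
theorem interior_boundaries_eq_empty (m : ℕ) (F : Fin m → Quad (Set.univ : Set ℂ)) :
    interior (⋃ i : Fin m, ⋃ j : Fin 4, (F i).side j) = ∅ := by
  classical
  choose T hTc hTi hTsub using fun p : Fin m × Fin 4 => exists_side_subset_closed_nowhereDense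
    (F p.1) p.2
  -- a finite union of closed sets with empty interior has empty interior
  have key : ∀ s : Finset (Fin m × Fin 4), interior (⋃ p ∈ s, T p) = ∅ := by
    intro s
    induction s using Finset.induction_on with
    | empty => simp
    | insert a s ha ih =>
      rw [Finset.set_biUnion_insert, interior_union_isClosed_of_interior_empty (hTc a) ih, hTi a]
  have hsub : (⋃ i : Fin m, ⋃ j : Fin 4, (F i).side j) ⊆ ⋃ p ∈ (Finset.univ : Finset (Fin m × Fin 4)), T p := by
    intro z hz
    simp only [Set.mem_iUnion] at hz
    obtain ⟨i, j, hz⟩ := hz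
    exact Set.mem_biUnion (Finset.mem_univ (i, j)) (hTsub (i, j) hz)
  exact Set.eq_empty_of_subset_empty ((interior_mono hsub).trans (key Finset.univ).subset)

/-! ## A good leaf -/

/-- **A leaf meeting a closed nowhere dense set in a totally disconnected set** (Baire). -/
theorem exists_leaf_subsingleton (H : ℂ ≃ₜ ℂ) {S : Set ℂ} (hS : IsClosed S)
    (hSint : interior S = ∅) :
    ∃ a ∈ Set.Ioo (-1 / 4 : ℝ) (1 / 4), ∀ C ⊆ H '' (Set.Icc (-2 : ℝ) 2 ×ℂ {a}) ∩ S,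
      IsPreconnected C → C.Subsingleton := by
  by_contra hcon
  push Not at hcon
  -- every leaf carries a rational segment inside `S`
  have hseg : ∀ a ∈ Set.Ioo (-1 / 4 : ℝ) (1 / 4), ∃ q : ℚ × ℚ, (q.1 : ℝ) < q.2 ∧
      ∀ x ∈ Set.Icc (q.1 : ℝ) q.2, H ((x : ℂ) + (a : ℂ) * Complex.I) ∈ S := by
    intro a ha
    obtain ⟨C, hCsub, hCconn, hCns⟩ := hcon a ha
    obtain ⟨p, hp, q, hq, hpq⟩ := hCns
    -- chart preimage
    set C' : Set ℂ := H.symm '' C with hC'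
    have hC'conn : IsPreconnected C' := hCconn.image _ H.symm.continuous.continuousOn
    have hC'sub : ∀ w ∈ C', w.im = a ∧ w.re ∈ Set.Icc (-2 : ℝ) 2 ∧ H w ∈ S := by
      rintro _ ⟨z, hz, rfl⟩
      obtain ⟨⟨w, hw, hwz⟩, hzS⟩ := hCsub hz
      rw [← hwz, Homeomorph.symm_apply_apply]
      rw [Complex.mem_reProdIm, Set.mem_singleton_iff] at hw
      exact ⟨hw.2, hw.1, hwz ▸ hzS⟩
    have hre : IsPreconnected (Complex.re '' C') := hC'conn.image _ Complex.continuous_re.continuousOn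
    have hp' : (H.symm p).re ∈ Complex.re '' C' := ⟨H.symm p, Set.mem_image_of_mem _ hp, rfl⟩
    have hq' : (H.symm q).re ∈ Complex.re '' C' := ⟨H.symm q, Set.mem_image_of_mem _ hq, rfl⟩
    have hne : (H.symm p).re ≠ (H.symm q).re := by
      intro h
      apply hpq
      have hpi := (hC'sub _ (Set.mem_image_of_mem _ hp)).1
      have hqi := (hC'sub _ (Set.mem_image_of_mem _ hq)).1
      have : H.symm p = H.symm q := Complex.ext h (by rw [hpi, hqi])
      exact H.symm.injective this
    -- the segment between the two abscissae
    set x₁ := min (H.symm p).re (H.symm q).re with hx₁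
    set x₂ := max (H.symm p).re (H.symm q).re with hx₂
    have hx₁₂ : x₁ < x₂ := min_lt_max.2 hne
    have hIcc : Set.Icc x₁ x₂ ⊆ Complex.re '' C' := by
      rcases le_total (H.symm p).re (H.symm q).re with h | h
      · rw [hx₁, hx₂, min_eq_left h, max_eq_right h]; exact hre.Icc_subset hp' hq'
      · rw [hx₁, hx₂, min_eq_right h, max_eq_left h]; exact hre.Icc_subset hq' hp'
    have hmemS : ∀ x ∈ Set.Icc x₁ x₂, H ((x : ℂ) + (a : ℂ) * Complex.I) ∈ S := by
      intro x hx
      obtain ⟨w, hw, hwx⟩ := hIcc hx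
      obtain ⟨hwi, -, hwS⟩ := hC'sub w hw
      have : w = (x : ℂ) + (a : ℂ) * Complex.I := Complex.ext (by simp [hwx]) (by simp [hwi])
      rwa [this] at hwS
    obtain ⟨q₁, hq₁, hq₁'⟩ := exists_rat_btwn hx₁₂
    obtain ⟨q₂, hq₂, hq₂'⟩ := exists_rat_btwn hq₁'
    exact ⟨(q₁, q₂), hq₂, fun x hx => hmemS x ⟨by linarith [hx.1], by linarith [hx.2]⟩⟩
  -- the closed cover of `ℝ`
  set f : Option (ℚ × ℚ) → Set ℝ := fun o => match o with
    | none => (Set.Ioo (-1 / 4 : ℝ) (1 / 4))ᶜ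
    | some q => {a ∈ Set.Icc (-1 / 4 : ℝ) (1 / 4) | (q.1 : ℝ) < q.2 ∧
        ∀ x ∈ Set.Icc (q.1 : ℝ) q.2, H ((x : ℂ) + (a : ℂ) * Complex.I) ∈ S} with hf
  have hfc : ∀ o, IsClosed (f o) := by
    rintro (_ | q)
    · exact isOpen_Ioo.isClosed_compl
    · simp only [hf]
      by_cases hq : (q.1 : ℝ) < q.2
      · have : {a ∈ Set.Icc (-1 / 4 : ℝ) (1 / 4) | (q.1 : ℝ) < q.2 ∧
            ∀ x ∈ Set.Icc (q.1 : ℝ) q.2, H ((x : ℂ) + (a : ℂ) * Complex.I) ∈ S} =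
            Set.Icc (-1 / 4 : ℝ) (1 / 4) ∩ ⋂ x ∈ Set.Icc (q.1 : ℝ) q.2,
              (fun a : ℝ => H ((x : ℂ) + (a : ℂ) * Complex.I)) ⁻¹' S := by
          ext a
          simp only [Set.mem_setOf_eq, Set.mem_inter_iff, Set.mem_iInter, Set.mem_preimage, hq,
            true_and]
        rw [this]
        exact isClosed_Icc.inter (isClosed_biInter fun x _ =>
          hS.preimage (H.continuous.comp (by fun_prop)))
      · have : {a ∈ Set.Icc (-1 / 4 : ℝ) (1 / 4) | (q.1 : ℝ) < q.2 ∧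
            ∀ x ∈ Set.Icc (q.1 : ℝ) q.2, H ((x : ℂ) + (a : ℂ) * Complex.I) ∈ S} = ∅ := by
          ext a
          simp only [Set.mem_setOf_eq, hq, false_and, and_false, Set.mem_empty_iff_false]
        rw [this]
        exact isClosed_empty
  have hfU : ⋃ o, f o = Set.univ := by
    refine Set.eq_univ_of_forall fun a => ?_
    by_cases ha : a ∈ Set.Ioo (-1 / 4 : ℝ) (1 / 4)
    · obtain ⟨q, hq, hqS⟩ := hseg a ha
      exact Set.mem_iUnion.2 ⟨some q, ⟨Set.Ioo_subset_Icc_self ha, hq, hqS⟩⟩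
    · exact Set.mem_iUnion.2 ⟨none, ha⟩
  have hdense := dense_iUnion_interior_of_closed hfc hfU
  -- an interior point inside `(-¼, ¼)`
  obtain ⟨a₀, ha₀', ha₀⟩ := hdense.inter_open_nonempty (Set.Ioo (-1 / 4 : ℝ) (1 / 4)) isOpen_Ioo
    ⟨0, by norm_num, by norm_num⟩
  obtain ⟨o, ho⟩ := Set.mem_iUnion.1 ha₀
  rcases o with _ | q
  · exact (interior_subset ho) ha₀'
  · obtain ⟨ε, hε, hball⟩ := Metric.isOpen_iff.1 isOpen_interior a₀ ho
    have hq : (q.1 : ℝ) < q.2 := ((interior_subset (hball (Metric.mem_ball_self hε))).2).1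
    -- the open box `(q₁,q₂) × (a₀-ε, a₀+ε)` maps into `S`
    have hbox : H '' (Set.Ioo (q.1 : ℝ) q.2 ×ℂ Set.Ioo (a₀ - ε) (a₀ + ε)) ⊆ S := by
      rintro _ ⟨w, hw, rfl⟩
      rw [Complex.mem_reProdIm] at hw
      have ha : w.im ∈ Metric.ball a₀ ε := by
        rw [Metric.mem_ball, Real.dist_eq, abs_lt]
        constructor <;> linarith [hw.2.1, hw.2.2]
      have h := ((interior_subset (hball ha)).2).2 w.re (Set.Ioo_subset_Icc_self hw.1)
      have hw' : (w.re : ℂ) + (w.im : ℂ) * Complex.I = w := Complex.re_add_im w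
      rwa [hw'] at h
    have hopen : IsOpen (H '' (Set.Ioo (q.1 : ℝ) q.2 ×ℂ Set.Ioo (a₀ - ε) (a₀ + ε))) :=
      H.isOpenMap _ (isOpen_Ioo.reProdIm isOpen_Ioo)
    have hne : (H '' (Set.Ioo (q.1 : ℝ) q.2 ×ℂ Set.Ioo (a₀ - ε) (a₀ + ε))).Nonempty := by
      refine ⟨H ((((q.1 : ℝ) + q.2) / 2 : ℝ) + (a₀ : ℂ) * Complex.I), Set.mem_image_of_mem _ ?_⟩
      rw [Complex.mem_reProdIm]
      constructor
      · simp only [Complex.add_re, Complex.ofReal_re, Complex.mul_re, Complex.I_re, mul_zero,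
          Complex.ofReal_im, Complex.I_im, mul_one, sub_self, add_zero, Set.mem_Ioo]
        constructor <;> linarith
      · simp only [Complex.add_im, Complex.ofReal_im, Complex.mul_im, Complex.I_re, mul_zero,
          Complex.ofReal_re, Complex.I_im, mul_one, zero_add, add_zero, Set.mem_Ioo]
        constructor <;> linarith
    have hint : (interior S).Nonempty :=
      hne.mono (interior_maximal hbox hopen)
    rw [hSint] at hint
    exact Set.not_nonempty_empty hint

end Summit.CriticalPhenomena.CardyFormulaZ2.Theorems.CardySelfRefinement

end
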